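import Summits.QuantumFields.YangMills.Theorems.BalabanUVNodesPortS1ChartJacobianFull

/-!
# NODE O port PT-A — FE-1's chart law (T1), brick (B-γ1) of `Lines/pta_residueW-CHART-LAW-PROOF-PLAN-v1.md` §2: THE DUMMY-COORDINATE REDUCTION — the bond variables an integrand does NOT read
# integrate out to a displayed constant ([I] p.268: «the integration over the variables `V′(b₀(c))` … gives a constant», (2.10)–(2.12)); pure product-measure bookkeeping, three carriers

Cell `ym-nodeO-ideate`, porter seat PT-A-1 (gen 10); `--kind proof --supports stmt-QuantumFields-27930 --as helper`; count-neutral.  [I] = [Balaban1987RG1]; [16] = [Balaban1985UV3].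
Over ✓`…PortS1ChartJacobian{,Pi,Record,Full}` ((o2): `chartAt`, `chartPi`, `chartJac`, `fluctSigma`, `sigmaMeasure_restrict_ball_eq_smul`, `sigmaMeasure_ball_pi`, `haar_restrict_chartAt_image`,
`setIntegral_pi_haar_chartPi_image`, `fieldMeasure_eq_pi_haarProbability`) and Mathlib's `measurePreserving_piEquivPiSubtypeProd` ∕ `Measure.restrict_pi_pi` ∕ `integral_prod_smul` ∕ `integral_fintype_prod_eq_prod`.

WHAT IS PROVED (no measurability hypothesis anywhere in §1–§2: the split is an identity of Bochner integrals along a measure-preserving equivalence).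
* §1 (abstract, any finite index type `ι`, σ-finite `μ i`, sets `S i`, weights `w i`, values in a real Banach space) ★ `setIntegral_pi_prod_smul_of_indep` — for `g` invariant under the coordinates in a
  decidable set `p`, `∫_{Π S} (Π_i w_i(x_i)) • g(x) d(⊗μ) = (Π_{i ∈ p} ∫_{S_i} w_i dμ_i) • ∫_{Π_{i ∉ p} S} (Π_{j ∉ p} w_j(y_j)) • g(ext_c y) d(⊗_{j ∉ p} μ)`, `ext_c y` = `y` off `p`, the dummy value `c` on `p`;
  `setIntegral_pi_of_indep` (no weight: the factor is `Π_{i ∈ p} μ_i(S_i)`).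
* §2 (Haar side at the record) ★★ `setIntegral_fieldMeasure_pi_of_indep` — on `⊗_b dV(b) = fieldMeasure (F.P K) k (SU 2)`: `∫_{Π_b S_b} f dV = (Π_{b ∈ p} dU(S_b)) • ∫_{Π_{b ∉ p} S_b} f(ext_c V′) d(⊗_{b ∉ p} dU)`
  for `f` blind to the bonds in `p`; `haarProbability_real_image_chartAt_ball_pi` (a radius-`π` chart window at any centre has mass `1`, so at `s = π` the factor is `1`: `setIntegral_fieldMeasure_window_pi_of_indep`).
* §3 (flat side) ★ `setIntegral_fluctSigma_smul_of_indep` — on `ι → ℝ³` with print's Jacobian `σ = fluctSigma = Π_b chartJac`: the dummies contribute `(∫_{B_s} chartJac)^{#p}`;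
  `sigmaSU2_zero_mul_integral_chartJac_ball` (`σ₀ · ∫_{B_s} chartJac = σdA(B_s)`), ★ `integral_chartJac_ball_pi` (`∫_{B_π} chartJac = σ₀⁻¹`) — so after (2.10)'s prefactor `σ₀^{#T_k}` exactly `σ₀^{#(T_k ∖ p)}` survives.
* §4 ★★ `setIntegral_fieldMeasure_window_eq_chart_nonDummy` — (2.10) WITH THE DUMMIES GONE: for `f` blind to the bonds in `p` and `s ≤ π`,
  `∫_{window_s(Vk)} f dV = σdA(B_s)^{#p} • σ₀^{#¬p} • ∫_{|A′_b| < s, b ∉ p} σ(A′) • f(ext_{Vk}((exp(iA′_b)Vk(b))_b)) dA′` (✓`setIntegral_pi_haar_chartPi_image` on the sub-product).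

HONEST FRAMING.  Measure-theoretic bookkeeping only (Fubini over `Π_{i∈p} × Π_{i∉p}`); the USE — that N11's fibre density and chart point do not read the central bonds ((B-γ2)), the solved coordinate
((B-e)), the density in coordinates ((B-d′)) and the assembly ((B-★)) — is NOT here; nothing of Bałaban's (2.10)–(2.14) estimates asserted; `FEChartLawStep`∕`FEStepBox` inhabited nowhere;
`stub_P0C`∕`stub_FEstep` OPEN; ⟨27930⟩ OPEN 1∕3; NODE O 0∕1; COUNT 8∕28 · K 1∕4 UNMOVED; finite `𝕋⁴_{L^K}` at fixed ε — NOT continuum ∕ OS; **the Yang–Mills mass gap (Clay) is NOT proved by any of this.**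
No `sorry`, no `def`, no `instance`; standard axioms only.
-/

noncomputable section

open MeasureTheory MeasureTheory.Measure Set Metric
open scoped ENNReal BigOperators

namespace Summit.QuantumFields.YangMills.Theorems.BalabanUVNodesPortS1

open Literature.MathematicalPhysics.QuantumFieldTheory (haarProbability)
open Literature.MathematicalPhysics.QuantumFieldTheory.Balaban1983to89
open Literature.MathematicalPhysics.QuantumFieldTheory.Balaban1983to89.Node00
open Literature.MathematicalPhysics.QuantumFieldTheory.Balaban1983to89.T4Continuum (T4Family)
open Literature.MathematicalPhysics.QuantumFieldTheory.Balaban1983to89.B10Eq22Rescaling (sigmaSU2 sigmaSU2_zero)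
open Literature.MathematicalPhysics.QuantumFieldTheory.Balaban1983to89.B10Eq18SigmaSU2Haar

/-! ## §1  The abstract dummy-coordinate reduction over a finite product -/

section Abstract

variable {ι : Type*} [Fintype ι] {E : Type*} [MeasurableSpace E] {G : Type*} [NormedAddCommGroup G] [NormedSpace ℝ G]

/-- ★ **DUMMY COORDINATES INTEGRATE OUT (weighted product form)**: on `⊗_i μ_i` restricted to the box `Π_i S_i`, for an integrand `(Π_i w_i(x_i)) • g(x)` whose `g` does not read the coordinates in the
decidable set `p`, the `p`-coordinates contribute the constant `Π_{i ∈ p} ∫_{S_i} w_i dμ_i` and the rest is the same integral over the remaining coordinates, `g` read at the extension by any dummy value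
`c`.  No measurability hypothesis (an identity of Bochner integrals along the measure-preserving split `Π_i ≃ Π_{i∈p} × Π_{i∉p}`). [cite: Balaban1987RG1, (2.10)–(2.12) pp.267–268 (bookkeeping)] -/
theorem setIntegral_pi_prod_smul_of_indep (μ : ι → Measure E) [∀ i, SigmaFinite (μ i)] (p : ι → Prop) [DecidablePred p]
    (w : ι → E → ℝ) (S : ι → Set E) (g : (ι → E) → G) (c : ι → E) (hg : ∀ x x' : ι → E, (∀ i, ¬ p i → x i = x' i) → g x = g x') :
    ∫ x in Set.pi univ S, (∏ i, w i (x i)) • g x ∂(Measure.pi μ) =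
      (∏ i : {i // p i}, ∫ y in S i, w i y ∂(μ i)) •
        ∫ y : {i // ¬ p i} → E in Set.pi univ (fun j : {i // ¬ p i} => S j), (∏ j : {i // ¬ p i}, w j (y j)) • g (fun i => if h : p i then c i else y ⟨i, h⟩)
          ∂(Measure.pi fun j : {i // ¬ p i} => μ j) := by
  rw [Measure.restrict_pi_pi, Measure.restrict_pi_pi]
  set μ' : ι → Measure E := fun i => (μ i).restrict (S i) with hμ'
  set e := MeasurableEquiv.piEquivPiSubtypeProd (fun _ : ι => E) p with he
  have hme : MeasurePreserving e (Measure.pi μ') ((Measure.pi fun i : {i // p i} => μ' i).prod (Measure.pi fun i : {i // ¬ p i} => μ' i)) :=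
    measurePreserving_piEquivPiSubtypeProd μ' p
  have hsymm_apply : ∀ (z : ({i // p i} → E) × ({i // ¬ p i} → E)) (i : ι), e.symm z i = if h : p i then z.1 ⟨i, h⟩ else z.2 ⟨i, h⟩ :=
    fun z i => rfl
  rw [← hme.symm.integral_comp' (g := fun x : ι → E => (∏ i, w i (x i)) • g x)]
  have hfac : ∀ z : ({i // p i} → E) × ({i // ¬ p i} → E),
      (fun x : ι → E => (∏ i, w i (x i)) • g x) (e.symm z) =
        (∏ i : {i // p i}, w i (z.1 i)) • ((∏ j : {i // ¬ p i}, w j (z.2 j)) • g (fun i => if h : p i then c i else z.2 ⟨i, h⟩)) := by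
    intro z
    show (∏ i, w i (e.symm z i)) • g (e.symm z) = _
    rw [← mul_smul, ← Fintype.prod_subtype_mul_prod_subtype p (fun i => w i (e.symm z i))]
    have h1 : (∏ i : {i // p i}, w i (e.symm z i)) = ∏ i : {i // p i}, w i (z.1 i) :=
      Finset.prod_congr rfl fun i _ => by rw [hsymm_apply, dif_pos i.2]
    have h2 : (∏ i : {i // ¬ p i}, w i (e.symm z i)) = ∏ i : {i // ¬ p i}, w i (z.2 i) :=
      Finset.prod_congr rfl fun i _ => by rw [hsymm_apply, dif_neg i.2]
    have h3 : g (e.symm z) = g (fun i => if h : p i then c i else z.2 ⟨i, h⟩) :=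
      hg _ _ fun i hi => by rw [hsymm_apply, dif_neg hi, dif_neg hi]
    rw [h1, h2, h3]
  simp_rw [hfac]
  rw [integral_prod_smul (fun z₁ : {i // p i} → E => ∏ i : {i // p i}, w i (z₁ i))
      (fun z₂ : {i // ¬ p i} → E => (∏ j : {i // ¬ p i}, w j (z₂ j)) • g (fun i => if h : p i then c i else z₂ ⟨i, h⟩)),
    integral_fintype_prod_eq_prod (fun (i : {i // p i}) (y : E) => w i y)]

/-- **DUMMY COORDINATES INTEGRATE OUT (plain form)**: `∫_{Π S} g d(⊗μ) = (Π_{i ∈ p} μ_i(S_i)) • ∫_{Π_{i∉p} S} g(ext_c y) d(⊗_{i∉p} μ)` for `g` blind to the coordinates in `p`.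
[cite: Balaban1987RG1, (2.10)–(2.12) pp.267–268 (bookkeeping)] -/
theorem setIntegral_pi_of_indep (μ : ι → Measure E) [∀ i, SigmaFinite (μ i)] (p : ι → Prop) [DecidablePred p]
    (S : ι → Set E) (g : (ι → E) → G) (c : ι → E) (hg : ∀ x x' : ι → E, (∀ i, ¬ p i → x i = x' i) → g x = g x') :
    ∫ x in Set.pi univ S, g x ∂(Measure.pi μ) =
      (∏ i : {i // p i}, (μ i).real (S i)) •
        ∫ y : {i // ¬ p i} → E in Set.pi univ (fun j : {i // ¬ p i} => S j), g (fun i => if h : p i then c i else y ⟨i, h⟩) ∂(Measure.pi fun j : {i // ¬ p i} => μ j) := by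
  have h := setIntegral_pi_prod_smul_of_indep μ p (fun _ _ => (1 : ℝ)) S g c hg
  simp only [Finset.prod_const_one, one_smul] at h
  rw [h]
  congr 1
  exact Finset.prod_congr rfl fun i _ => by rw [setIntegral_const, smul_eq_mul, mul_one]

end Abstract

/-! ## §2  Haar side at the record: the bond variables `f` does not read -/

section Haar

variable (F : T4Family)

/-- ★★ **AT THE RECORD, HAAR SIDE**: on `dV = ⊗_b dU(b)` of the level-`k` bond variables (`fieldMeasure (F.P K) k (SU 2)`), for `f` blind to the bonds in the decidable set `p` and any box `Π_b S_b`,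
`∫_{Π_b S_b} f dV = (Π_{b ∈ p} dU(S_b)) • ∫_{Π_{b ∉ p} S_b} f(ext_c V′) d(⊗_{b∉p} dU)` — «the integration over the variables the integrand does not depend on gives a constant».
[cite: Balaban1987RG1, p.268, (2.10)–(2.12) pp.267–268] [cite: Balaban1985Averaging, (10) p.19] -/
theorem setIntegral_fieldMeasure_pi_of_indep {G : Type*} [NormedAddCommGroup G] [NormedSpace ℝ G] (K k : ℕ) (p : PBond (F.P K) k → Prop) [DecidablePred p]
    (S : PBond (F.P K) k → Set (SU 2)) (f : GaugeField (F.P K) k (SU 2) → G) (c : GaugeField (F.P K) k (SU 2))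
    (hf : ∀ V V' : GaugeField (F.P K) k (SU 2), (∀ b, ¬ p b → V b = V' b) → f V = f V') :
    ∫ V in Set.pi univ S, f V ∂(fieldMeasure (F.P K) k (SU 2)) =
      (∏ b : {b // p b}, (haarProbability (Matrix.specialUnitaryGroup (Fin 2) ℂ)).real (S b)) •
        ∫ V' : {b // ¬ p b} → SU 2 in Set.pi univ (fun b => S b), f (fun b => if h : p b then c b else V' ⟨b, h⟩)
          ∂(Measure.pi fun _ : {b // ¬ p b} => haarProbability (Matrix.specialUnitaryGroup (Fin 2) ℂ)) := by
  rw [fieldMeasure_eq_pi_haarProbability]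
  exact setIntegral_pi_of_indep (fun _ => haarProbability (Matrix.specialUnitaryGroup (Fin 2) ℂ)) p S f c hf

/-- The radius-`π` chart window at any centre has Haar probability `1` (real form of ✓`haar_image_chartAt_ball_pi`). [cite: Balaban1985UV3, (18) p.260] -/
theorem haarProbability_real_image_chartAt_ball_pi (u : Matrix.specialUnitaryGroup (Fin 2) ℂ) :
    (haarProbability (Matrix.specialUnitaryGroup (Fin 2) ℂ)).real (chartAt u '' ball (0 : EuclideanSpace ℝ (Fin 3)) Real.pi) = 1 := by
  rw [measureReal_def, haar_image_chartAt_ball_pi, ENNReal.toReal_one]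

/-- ★ **AT THE RECORD, RADIUS-`π` WINDOW**: for `f` blind to the bonds in `p`, the full-window integral `∫_{window_π(Vk)} f dV` IS the reduced one (the dummy windows have mass `1`).
[cite: Balaban1987RG1, p.268, (2.10) p.267] [cite: Balaban1985UV3, (18) p.260] -/
theorem setIntegral_fieldMeasure_window_pi_of_indep {G : Type*} [NormedAddCommGroup G] [NormedSpace ℝ G] (K k : ℕ) (p : PBond (F.P K) k → Prop) [DecidablePred p]
    (Vk : GaugeField (F.P K) k (SU 2)) (f : GaugeField (F.P K) k (SU 2) → G) (c : GaugeField (F.P K) k (SU 2))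
    (hf : ∀ V V' : GaugeField (F.P K) k (SU 2), (∀ b, ¬ p b → V b = V' b) → f V = f V') :
    ∫ V in Set.pi univ (fun b : PBond (F.P K) k => chartAt (Vk b) '' ball (0 : EuclideanSpace ℝ (Fin 3)) Real.pi), f V ∂(fieldMeasure (F.P K) k (SU 2)) =
      ∫ V' : {b // ¬ p b} → SU 2 in Set.pi univ (fun b : {b // ¬ p b} => chartAt (Vk b) '' ball (0 : EuclideanSpace ℝ (Fin 3)) Real.pi),
        f (fun b => if h : p b then c b else V' ⟨b, h⟩) ∂(Measure.pi fun _ : {b // ¬ p b} => haarProbability (Matrix.specialUnitaryGroup (Fin 2) ℂ)) := by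
  rw [setIntegral_fieldMeasure_pi_of_indep F K k p _ f c hf]
  simp only [haarProbability_real_image_chartAt_ball_pi, Finset.prod_const_one, one_smul]

end Haar

/-! ## §3  Flat side: print's Jacobian `σ = Π_b chartJac` and the count `∫_{B_π} chartJac = σ₀⁻¹` -/

section Flat

variable {ι : Type*} [Fintype ι] {G : Type*} [NormedAddCommGroup G] [NormedSpace ℝ G]

/-- ★ **FLAT SIDE**: on `ι → ℝ³` with Lebesgue measure and print's Jacobian weight `σ(A) = Π_b chartJac(A_b)`, for `g` blind to the coordinates in `p`,
`∫_{|A_b|<s ∀ b} σ(A) • g(A) dA = (∫_{B_s} chartJac)^{#p} • ∫_{|A′_b|<s, b∉p} σ(A′) • g(ext_c A′) dA′`. [cite: Balaban1987RG1, (2.10) p.267, p.268] [cite: Balaban1985UV3, (18) p.260] -/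
theorem setIntegral_fluctSigma_smul_of_indep (p : ι → Prop) [DecidablePred p] (s : ℝ) (g : (ι → EuclideanSpace ℝ (Fin 3)) → G) (c : ι → EuclideanSpace ℝ (Fin 3))
    (hg : ∀ A A' : ι → EuclideanSpace ℝ (Fin 3), (∀ i, ¬ p i → A i = A' i) → g A = g A') :
    ∫ A in Set.pi univ (fun _ : ι => ball (0 : EuclideanSpace ℝ (Fin 3)) s), fluctSigma A • g A =
      (∫ a in ball (0 : EuclideanSpace ℝ (Fin 3)) s, chartJac a) ^ Fintype.card {i // p i} •
        ∫ A' : {i // ¬ p i} → EuclideanSpace ℝ (Fin 3) in Set.pi univ (fun _ => ball (0 : EuclideanSpace ℝ (Fin 3)) s),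
          fluctSigma A' • g (fun i => if h : p i then c i else A' ⟨i, h⟩) := by
  have h := setIntegral_pi_prod_smul_of_indep (fun _ : ι => (volume : Measure (EuclideanSpace ℝ (Fin 3)))) p (fun _ a => chartJac a)
    (fun _ => ball (0 : EuclideanSpace ℝ (Fin 3)) s) g c hg
  rw [volume_pi]
  unfold fluctSigma
  rw [h, Finset.prod_const, Finset.card_univ]
  rfl

/-- `σ₀ · ∫_{B_s} chartJac dA = σdA(B_s)` for `s ≤ π` (✓`sigmaMeasure_restrict_ball_eq_smul`, read on `univ`). [cite: Balaban1985UV3, (18) p.260] [cite: Balaban1987RG1, (2.10) p.267] -/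
theorem sigmaSU2_zero_mul_integral_chartJac_ball {s : ℝ} (hs : s ≤ Real.pi) :
    sigmaSU2 0 * ∫ a in ball (0 : EuclideanSpace ℝ (Fin 3)) s, chartJac a = (sigmaMeasure (ball (0 : EuclideanSpace ℝ (Fin 3)) s)).toReal := by
  have h0 : 0 ≤ sigmaSU2 0 := by rw [sigmaSU2_zero]; positivity
  have hint : ∫ a in ball (0 : EuclideanSpace ℝ (Fin 3)) s, chartJac a =
      (∫⁻ a in ball (0 : EuclideanSpace ℝ (Fin 3)) s, ENNReal.ofReal (chartJac a)).toReal :=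
    integral_eq_lintegral_of_nonneg_ae (Filter.Eventually.of_forall fun a => chartJac_nonneg a) measurable_chartJac.aestronglyMeasurable
  have hmass := congrArg (fun ν : Measure (EuclideanSpace ℝ (Fin 3)) => ν univ) (sigmaMeasure_restrict_ball_eq_smul hs)
  simp only [Measure.restrict_apply_univ, Measure.smul_apply, withDensity_apply _ MeasurableSet.univ, Measure.restrict_univ, smul_eq_mul] at hmass
  rw [hint, ← ENNReal.toReal_ofReal h0, ← ENNReal.toReal_mul, ← hmass]

/-- ★ **THE COUNT `∫_{B_π} chartJac dA = σ₀⁻¹`** (`σdA(B_π) = 1`, ✓`sigmaMeasure_ball_pi`): each dummy bond of (2.10) at radius `π` returns exactly one inverse power of the displayed `σ₀`.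
[cite: Balaban1985UV3, (18) p.260] [cite: Balaban1987RG1, (2.10) p.267] -/
theorem integral_chartJac_ball_pi : ∫ a in ball (0 : EuclideanSpace ℝ (Fin 3)) Real.pi, chartJac a = (sigmaSU2 0)⁻¹ := by
  have h0 : 0 < sigmaSU2 0 := by rw [sigmaSU2_zero]; positivity
  have h := sigmaSU2_zero_mul_integral_chartJac_ball (le_refl Real.pi)
  rw [sigmaMeasure_ball_pi, ENNReal.toReal_one] at h
  exact eq_inv_of_mul_eq_one_right h

end Flat

/-! ## §4  (2.10) with the dummies gone -/

section Record

variable (F : T4Family)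

/-- ★★ **(2.10) AT THE RECORD WITH THE DUMMY BONDS INTEGRATED OUT**: for `f` blind to the bonds in `p`, `s ≤ π`, and `f ∘ ext_{Vk}` a.e.-strongly measurable on the reduced window,
`∫_{window_s(Vk)} f dV = σdA(B_s)^{#p} • σ₀^{#¬p} • ∫_{|A′_b|<s, b∉p} σ(A′) • f(ext_{Vk}((exp(iA′_b)·Vk(b))_{b∉p})) dA′` — the Haar-side reduction (§2) followed by ✓`setIntegral_pi_haar_chartPi_image` on the
sub-product; at `s = π` the first factor is `1`. [cite: Balaban1987RG1, (2.4) p.266, (2.10) p.267, p.268] [cite: Balaban1985UV3, (18) p.260] -/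
theorem setIntegral_fieldMeasure_window_eq_chart_nonDummy {G : Type*} [NormedAddCommGroup G] [NormedSpace ℝ G] (K k : ℕ) (p : PBond (F.P K) k → Prop) [DecidablePred p]
    (Vk : GaugeField (F.P K) k (SU 2)) {s : ℝ} (hs : s ≤ Real.pi) (f : GaugeField (F.P K) k (SU 2) → G)
    (hf : ∀ V V' : GaugeField (F.P K) k (SU 2), (∀ b, ¬ p b → V b = V' b) → f V = f V')
    (hfm : AEStronglyMeasurable (fun V' : {b // ¬ p b} → SU 2 => f (fun b => if h : p b then Vk b else V' ⟨b, h⟩))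
      ((Measure.pi fun _ : {b // ¬ p b} => haarProbability (Matrix.specialUnitaryGroup (Fin 2) ℂ)).restrict
        (Set.pi univ fun b : {b // ¬ p b} => chartAt (Vk b) '' ball (0 : EuclideanSpace ℝ (Fin 3)) s))) :
    ∫ V in Set.pi univ (fun b : PBond (F.P K) k => chartAt (Vk b) '' ball (0 : EuclideanSpace ℝ (Fin 3)) s), f V ∂(fieldMeasure (F.P K) k (SU 2)) =
      (sigmaMeasure (ball (0 : EuclideanSpace ℝ (Fin 3)) s)).toReal ^ Fintype.card {b // p b} •
        ((sigmaSU2 0) ^ Fintype.card {b // ¬ p b} •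
          ∫ A' : {b // ¬ p b} → EuclideanSpace ℝ (Fin 3) in Set.pi univ (fun _ => ball (0 : EuclideanSpace ℝ (Fin 3)) s),
            fluctSigma A' • f (fun b => if h : p b then Vk b else chartPi (fun b' : {b // ¬ p b} => Vk b') A' ⟨b, h⟩)) := by
  rw [setIntegral_fieldMeasure_pi_of_indep F K k p _ f Vk hf]
  have hwin : ∀ b : {b // p b}, (haarProbability (Matrix.specialUnitaryGroup (Fin 2) ℂ)).real (chartAt (Vk b) '' ball (0 : EuclideanSpace ℝ (Fin 3)) s) =
      (sigmaMeasure (ball (0 : EuclideanSpace ℝ (Fin 3)) s)).toReal := by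
    intro b
    have h := congrArg (fun ν : Measure (Matrix.specialUnitaryGroup (Fin 2) ℂ) => ν univ) (haar_restrict_chartAt_image (Vk b) hs)
    simp only [Measure.restrict_apply_univ, Measure.map_apply (measurable_chartAt _) MeasurableSet.univ, preimage_univ] at h
    rw [measureReal_def, h]
  simp only [hwin, Finset.prod_const, Finset.card_univ]
  rw [setIntegral_pi_haar_chartPi_image (fun b' : {b // ¬ p b} => Vk b') hs _ hfm]

end Record

end Summit.QuantumFields.YangMills.Theorems.BalabanUVNodesPortS1

end
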